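import Summits.QuantumFields.YangMills.Theorems.UnitScaleTiltProp7TracePairing
import Literature.MathematicalPhysics.QuantumFieldTheory.Balaban1983to89.B10StarCount
import HarnessLib

/-!
# Route `UnitScaleTilt`, crux K1 «MinimiserStabilityRegPr» (stmt-QuantumFields-19200), route-R E′ S3 K-form engine (DESIGN-S3-KFORM-ENGINE-g15) — ROW R3′, GAUSS ROW (hX), THE PAIRING:
# COARSE SUMMATION BY PARTS — the face-flux pairing of the R3′ door, `X = Σ_c Re tr((φ(c₋) − V_cφ(c₊)V_c^*)ᴴ·W_c)`, equals `Σ_y Re tr(φ(y)ᴴ·NF(y))` with the transported NET FLUX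
# `NF(y) = Σ_μ (W(y,μ) − V(y−e_μ,μ)^*·W(y−e_μ,μ)·V(y−e_μ,μ))` (outflow minus the inflow carried back through the coarse bond variable) — exact

Cell `ym3-torus`, width seat `ym3-torus-px17` (gen 2; LOCATE-R3PRIME-COVFACEFLUX-px17g2.md §3, the summation-by-parts step between the door ✓p669468 `Prop7CovFaceFluxRow` (whose row `hX` is this
pairing) and the covariant Gauss law ✓p669014 `Prop7CovCombGauss` (whose outflow∕inflow∕interior-defect split evaluates `NF(y)`)).  THEOREMS ONLY (0 `def`, 0 `sorry`); `--supports stmt-QuantumFields-19200`,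
count-neutral.  YM₃ on T³ is a ladder rung (R3), not the Clay problem; nothing here claims a stub, the crux, d = 4 or the mass gap.

WHY.  Flat (✓ `Prop7FaceFlux.sum_faceFlux_mul_coarseGrad_eq_zero`): `Σ_c (g(c₊) − g(c₋))·FS(c) = −Σ_y g(y)·(net flux out of B(y)) = 0`.  Covariantly the coarse difference carries the coarse transport
`V_c` (R2′'s `Ū₀^{(k)}`, = the datum on the fibre), and moving it from `φ(c₊)` onto the flux by trace cyclicity produces the inflow term `V^*WV` read in the frame of the RECEIVING block —
this is where the coarse-transport junction `J_VH` of the LOCATE (§0.4) sits: `NF(y)` compares the comb-transported inflow of the Gauss law with `V^*WV`.  The identity needs no smallness and no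
unitarity: finite algebra, stated once in the door's letters.

WHAT IS PROVED (ns `…Theorems.Prop7CovFaceFluxPairing`; any `P`, level `k`, any square size): `trace_conj_pureGauge_mul` (one bond), ★★ `sum_re_trace_pureGauge_mul_eq` — the title identity
(re-indexing the inflow by ✓ `B10StarCount.shiftEquiv`).  No estimate is offered here: bounding `|X|` by `‖φ(y)‖·‖NF(y)‖` would be an ABSOLUTE-value booking of the potential (not a currency,
RULING g28-№2); the consumer expands `NF(y)` by ✓p669014 and moves each holonomy onto `φ(y)` as a commutator (LOCATE §0.2).
HONEST SCOPE.  An identity; nothing of Bałaban's asserted.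

References: T. Bałaban, CMP 95 (1984) 17–40 [Balaban1984PropagatorsI] ((1.21) p.21); CMP 98 (1985) 17–51 [Balaban1985Averaging] ((11) p.19); CMP 99 (1985) 389–434
[Balaban1985BackgroundPropagators] ((3.8) p.392); CMP 102 (1985) 277–309 [Balaban1985Variational] (Prop. 7 p.299).
-/

set_option autoImplicit false

noncomputable section

open scoped BigOperators Matrix

namespace Summit.QuantumFields.YangMills.Theorems.Prop7CovFaceFluxPairing

open Literature.MathematicalPhysics.QuantumFieldTheory.Balaban1983to89
open Finset
open B10StarCount (sum_pbond shift_unshift unshift_shift shiftEquiv)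

variable {P : Params} {k : ℕ} {n : Type*} [Fintype n]

/-- One bond: `tr((a − V b V^*)ᴴ·w) = tr(aᴴ·w) − tr(bᴴ·(V^*·w·V))` (`(V^*)ᴴ = V`, trace cyclicity). [folklore] -/
theorem trace_conj_pureGauge_mul (a b w : Matrix n n ℂ) (V : Matrix n n ℂ) :
    ((a - V * b * star V)ᴴ * w).trace = (aᴴ * w).trace - (bᴴ * (star V * w * V)).trace := by
  rw [Matrix.conjTranspose_sub, Matrix.sub_mul, Matrix.trace_sub, Matrix.conjTranspose_mul, Matrix.conjTranspose_mul, Matrix.star_eq_conjTranspose,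
    Matrix.conjTranspose_conjTranspose]
  congr 1
  rw [show V * (bᴴ * Vᴴ) * w = V * (bᴴ * (Vᴴ * w)) by noncomm_ring, Matrix.trace_mul_comm, show bᴴ * (Vᴴ * w) * V = bᴴ * (Vᴴ * w * V) by noncomm_ring]

/-- ★★ **COARSE SUMMATION BY PARTS FOR THE FACE-FLUX PAIRING**: for a coarse site function `φ`, coarse bond matrices `V` and a bond quantity `W`,
`Σ_c Re tr((φ(c₋) − V(c)φ(c₊)V(c)^*)ᴴ·W(c)) = Σ_y Re tr(φ(y)ᴴ·Σ_μ (W(y,μ) − V(y−e_μ,μ)^*·W(y−e_μ,μ)·V(y−e_μ,μ)))` — the coarse covariant difference moved onto the flux: outflow minus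
the inflow transported back through the coarse bond variable of the receiving block. [cite: Balaban1984PropagatorsI, (1.21) p.21; Balaban1985Averaging, (11) p.19] -/
theorem sum_re_trace_pureGauge_mul_eq (φ : Site P k → Matrix n n ℂ) (V : PBond P k → Matrix n n ℂ) (W : PBond P k → Matrix n n ℂ) :
    ∑ c : PBond P k, (((φ c.src - V c * φ c.tgt * star (V c))ᴴ * W c).trace).re
      = ∑ y : Site P k, (((φ y)ᴴ * ∑ μ : Fin P.d, (W ⟨y, μ⟩ - star (V ⟨y.unshift μ, μ⟩) * W ⟨y.unshift μ, μ⟩ * V ⟨y.unshift μ, μ⟩)).trace).re := by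
  classical
  -- per-`μ` letters: `A μ y` the outflow pairing, `B μ y` the inflow pairing read at the SENDING site `y`
  set A : Fin P.d → Site P k → ℝ := fun μ y => (((φ y)ᴴ * W ⟨y, μ⟩).trace).re with hA
  set B : Fin P.d → Site P k → ℝ := fun μ y => (((φ (y.shift μ))ᴴ * (star (V ⟨y, μ⟩) * W ⟨y, μ⟩ * V ⟨y, μ⟩)).trace).re with hB
  -- left side = Σ_μ Σ_y (A μ y − B μ y)
  have hL : ∑ c : PBond P k, (((φ c.src - V c * φ c.tgt * star (V c))ᴴ * W c).trace).re = ∑ μ : Fin P.d, ∑ y : Site P k, (A μ y - B μ y) := by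
    rw [sum_pbond (fun c : PBond P k => (((φ c.src - V c * φ c.tgt * star (V c))ᴴ * W c).trace).re), Finset.sum_comm]
    refine Finset.sum_congr rfl fun μ _ => Finset.sum_congr rfl fun y _ => ?_
    rw [trace_conj_pureGauge_mul, Complex.sub_re]
    rfl
  -- right side = Σ_μ Σ_y (A μ y − B μ (y − e_μ))
  have hR : ∑ y : Site P k, (((φ y)ᴴ * ∑ μ : Fin P.d, (W ⟨y, μ⟩ - star (V ⟨y.unshift μ, μ⟩) * W ⟨y.unshift μ, μ⟩ * V ⟨y.unshift μ, μ⟩)).trace).re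
      = ∑ μ : Fin P.d, ∑ y : Site P k, (A μ y - B μ (y.unshift μ)) := by
    rw [Finset.sum_comm]
    refine Finset.sum_congr rfl fun y _ => ?_
    rw [Matrix.mul_sum, Matrix.trace_sum, Complex.re_sum]
    refine Finset.sum_congr rfl fun μ _ => ?_
    rw [Matrix.mul_sub, Matrix.trace_sub, Complex.sub_re, hA, hB]
    simp only [shift_unshift]
  rw [hL, hR]
  refine Finset.sum_congr rfl fun μ _ => ?_
  rw [Finset.sum_sub_distrib, Finset.sum_sub_distrib]
  congr 1
  -- `Σ_y B μ y = Σ_y B μ (y − e_μ)`: re-index by the shift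
  exact (Fintype.sum_equiv (shiftEquiv μ) (fun y => B μ y) (fun y => B μ (y.unshift μ)) fun y => by
    simp only [shiftEquiv, Equiv.coe_fn_mk, unshift_shift])

end Summit.QuantumFields.YangMills.Theorems.Prop7CovFaceFluxPairing

end
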